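import Literature.Probability.LatticeModels.CurrentsPartialMonotonicity
import HarnessLib

/-!
# Conditioning random currents on the cluster of a vertex set; source insertion increases connection (Aizenman–Duminil-Copin 2021, Lemma A.1 for sets, Remark A.5, Corollary A.2 (second inequality))

Topic `Literature/Probability/LatticeModels`. For edge couplings `K ≥ 0` on a finite simple graph `G`
(`WeightedCurrents.lean`, `CurrentClusters.lean`: currents `Current G`, `ℝ≥0∞` weights
`w = Current.eweight K`, pair weights `epairWeight K A B (n₁,n₂) = 1{∂n₁ = A} 1{∂n₂ = B} w(n₁) w(n₂)`,
current sums `Z[A] = ecurrentSum K A`, restricted sums `Z_{G∖T}[B] = ecurrentSumIn (offGraph G T) K B`),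
this file extends the tree's conditioning-on-a-cluster machinery from the cluster `C_n(s)` of a
vertex (`Current.tsum_pair_eq_sum_cluster`, `CurrentClusters.lean`; Lemma A.1 for `C_{n₁+n₂}(s)`,
`CurrentsPartialMonotonicity.lean`) to the cluster `C_n(S) = ⋃_{x ∈ S} C_n(x)` **of a vertex set**,
which is the generality in which

* M. Aizenman, H. Duminil-Copin, *Marginal triviality of the scaling limits of critical 4D Ising and
  `φ⁴₄` models*, Ann. of Math. **194** (2021), arXiv:1912.07973, **Appendix A.1, Lemma A.1**
  [AizenmanDuminilCopinAnnals2021] is printed ("In this section, we set … `C_n(S) = ∪_{x∈S} C_n(x)`.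
  Lemma A.1. Let `A, B, S` be subsets of `Λ` and `F` a non-negative function defined over pairs of
  currents, which is determined by just the values of `(n₁,n₂)` along the edges touching the
  connected cluster `C_{n₁+n₂}(S)` and such that `F(n₁,n₂) = 0` whenever that cluster intersects
  `B` and `(∂n₁,∂n₂) = (A,B)`. Then
  `E^{A,B}_{Λ,β}[F] = E^{A,∅}_{Λ,β}[F ⟨σ_B⟩_{Λ∖C_{n₁+n₂}(S),β}/⟨σ_B⟩_{Λ,β}] ≤ E^{A,∅}_{Λ,β}[F]`"),

and which is needed for its two uses with a genuine set: **Remark A.5** ("The inequalities (A.6) and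
(A.7) can be extended to every set `S ⊂ ℤ^d` and every two vertices `x, y ∈ ℤ^d`:
`P^{0x,∅}_β[0 ↔ S] ≤ P^{0x,0y}_β[0 ↔ S] ≤ …`", first inequality) and, through it, the **second
inequality of Corollary A.2** ("`P^{0x,0z,∅,∅}_β[C_{n₁+n₃}(0) ∩ C_{n₂+n₄}(0) ∩ S ≠ ∅] ≤
P^{0x,0z,0y,0t}_β[C_{n₁+n₃}(0) ∩ C_{n₂+n₄}(0) ∩ S ≠ ∅]` … the second is new … The second identity
requires two successive applications of Lemma A.1. First, conditioning on `n₂+n₄`, the proposition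
applied to `𝐒 := C_{n₂+n₄}(0) ∩ S` … Similarly, conditioning on `n₁+n₃` …"), the monotonicity
invoked in the proof of the intersection-clustering bound, Prop. 4.3/6.1 ("Thanks to Corollary A.2,
the probability of `B_S` increases when removing sources, so that
`P^{0x,0z,0y,0t}[B_S] ≤ P^{0x,0z,∅,∅}[B_S]`", p. 14–15), on the way to the improved tree diagram bound
(the tree's named fact `aizenmanDuminilCopin_improvedTreeDiagramBound`).

## Contents (all finite-volume, current-sum form, general couplings `K ≥ 0`)

* `Current.clusterSet n W = ⋃_{s ∈ W} C_n(s)` with its API: no edge carrying current leaves it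
  (`eq_restrictTo_add_restrictTo_compl_set`), it only sees the edges meeting it
  (`clusterSet_eq_of_agree`), recombination and restriction (`clusterSet_add_eq_of_isSupp`,
  `clusterSet_restrictTo`);
* `Current.tsum_pair_eq_sum_clusterSet` — the decoupling identity across `C_{n₁+n₂}(W)` (the set
  version of `Current.tsum_pair_eq_sum_cluster`);
* **Lemma A.1 for sets**: `Current.tsum_epairWeight_eq_tsum_mul_offRatio_set` (identity, sources of
  the second current), `…_set_left` (sources of the first current),
  `Current.ecurrentSum_empty_mul_tsum_epairWeight_pair_le_set(_left)` (the inequality for a pair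
  `B = {a,b}`, Griffiths);
* **Remark A.5, first inequality** (`Current.ecurrentSum_empty_mul_tsum_avoidSet_le`, `…_left`):
  `Z[∅] · ∑ 1{∂n₁=A}1{∂n₂={u,a}} w w 𝟙[C_{n₁+n₂}(u) ∩ T = ∅] ≤ Z[{u,a}] · ∑ 1{∂n₁=A}1{∂n₂=∅} w w 𝟙[C_{n₁+n₂}(u) ∩ T = ∅]`,
  i.e. `P^{A,ua}[u ↮ T] ≤ P^{A,∅}[u ↮ T]`: inserting a pair of sources at `u` can only increase the
  probability that `u` is connected to `T`;
* **Corollary A.2, second inequality** (`Current.fourCurrent_avoidSet_mul_le`): for the four currents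
  `(n₁,n₃) ⊗ (n₂,n₄)` with `∂n₁ = A₁`, `∂n₂ = A₂` arbitrary and the sources `{u,a}` of `n₃`, `{u,b}` of
  `n₄` removed,
  `M^{A₁,ua ; A₂,ub}[C_{n₁+n₃}(u) ∩ C_{n₂+n₄}(u) ∩ T = ∅] · Z[∅]² ≤ Z[{u,a}] Z[{u,b}] · M^{A₁,∅ ; A₂,∅}[same]`
  for the un-normalised masses `M`, i.e. `P^{…,ua,…,ub}[𝒯_u ∩ T = ∅] ≤ P^{…,∅,…,∅}[𝒯_u ∩ T = ∅]`,
  equivalently the printed `P^{∅,∅}[𝒯_u ∩ T ≠ ∅] ≤ P^{ua,ub}[𝒯_u ∩ T ≠ ∅]`; and the variant with the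
  removed sources on the first currents of the pairs (`Current.fourCurrent_avoidSet_mul_le_left`),
  matching the source layout `P^{uy,ux} ⊗ P^{ut,uz}` of the tree's `Current.clusteringMass`
  (`ClusteringToTreeBound.lean`).

No named fact is introduced; everything is proved. Infinite-volume versions (`Λ ↑ ℤ^d`) are not
taken here.

## Proof

Word for word the single-vertex proofs of the tree with `C(s)` replaced by `C(W)`: an edge carrying
current with one endpoint in `C(W)` has both (so a pair of currents splits along `C_{n₁+n₂}(W) = T`
into inside parts living in `T` and outside parts supported off `T`, weights multiply, and
`(m, k) ↦ m + k` is a bijection), the cluster of the recombined current is again `T`, and `C(W)` is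
determined by the edges meeting it. Lemma A.1 then follows by summing the free outside part of the
second current (`Z_{G∖T}[B]` versus `Z_{G∖T}[∅]`) and Griffiths' inequality
`Z_{G∖T}[{a,b}] Z[∅] ≤ Z[{a,b}] Z_{G∖T}[∅]` (`Current.offRatio_pair_mul_le`). For Remark A.5 take
`W = T` (the target set), `F = 𝟙[u ∉ C_{n₁+n₂}(T)]` and `B = {u,a}`: `F` is local, and if
`a ∈ C(T)` then `u ∈ C(T)` because `u ↔ a` in `n₂` (`∂n₂ = {u,a}`), so `F` vanishes whenever `C(T)`
meets `B`. Corollary A.2 applies this twice, freezing one pair of currents at a time (Fubini).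

## References

* M. Aizenman, H. Duminil-Copin, Ann. of Math. 194 (2021), arXiv:1912.07973, Appendix A.1: Lemma A.1,
  Corollary A.2 (second inequality and its proof), Remark A.5; §4.2, proof of Prop. 4.3 (use of
  Cor. A.2), §6.1 Prop. 6.1 [AizenmanDuminilCopinAnnals2021].
* H. Tasaki, T. Hara (2015), App. A, Lemma A.19 [TasakiHara2015] — the decoupling mechanism, through
  `CurrentClusters.lean`.
-/

noncomputable section

open Finset Filter
open scoped symmDiff ENNReal

namespace Literature.Probability.LatticeModels

variable {V : Type*} [Fintype V] [DecidableEq V] {G : SimpleGraph V} [DecidableRel G.Adj]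

namespace Current

/-! ### Clusters of vertex sets -/

/-- The cluster `C_n(W) = ⋃_{s ∈ W} C_n(s)` of a vertex set in (the trace of) a current
(Aizenman–Duminil-Copin 2021, Appendix A.1: "we … write `C_n(S) = ∪_{x∈S} C_n(x)`").
[cite: AizenmanDuminilCopinAnnals2021, arXiv:1912.07973 Appendix A.1, notation before Lemma A.1] -/
def clusterSet (n : Current G) (W : Finset V) : Finset V := W.biUnion n.cluster

/-- Membership in `C_n(W)`. [folklore] -/
theorem mem_clusterSet_iff {n : Current G} {W : Finset V} {v : V} :
    v ∈ n.clusterSet W ↔ ∃ s ∈ W, v ∈ n.cluster s := Finset.mem_biUnion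

/-- `W ⊆ C_n(W)`. [folklore] -/
theorem subset_clusterSet (n : Current G) (W : Finset V) : W ⊆ n.clusterSet W :=
  fun s hs => mem_clusterSet_iff.2 ⟨s, hs, mem_cluster_self n s⟩

/-- `C_n(s) ⊆ C_n(W)` for `s ∈ W`. [folklore] -/
theorem cluster_subset_clusterSet (n : Current G) {W : Finset V} {s : V} (hs : s ∈ W) :
    n.cluster s ⊆ n.clusterSet W :=
  fun _ hv => mem_clusterSet_iff.2 ⟨s, hs, hv⟩

/-- `C_n(W)` is monotone in the current. [folklore] -/
theorem clusterSet_mono {n n' : Current G} (h : n ≤ n') (W : Finset V) :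
    n.clusterSet W ⊆ n'.clusterSet W := fun v hv => by
  obtain ⟨s, hs, hv⟩ := mem_clusterSet_iff.1 hv
  exact mem_clusterSet_iff.2 ⟨s, hs, cluster_mono h s hv⟩

/-- An open edge from a vertex of `C_n(W)` leads into `C_n(W)`. [folklore] -/
theorem mem_clusterSet_of_adj {n : Current G} {W : Finset V} {u w : V} (hu : u ∈ n.clusterSet W)
    (h : (Percolation.openGraph n.traced).Adj u w) : w ∈ n.clusterSet W := by
  obtain ⟨s, hs, hu⟩ := mem_clusterSet_iff.1 hu
  exact mem_clusterSet_iff.2 ⟨s, hs, mem_cluster_of_adj hu h⟩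

/-- A traced edge meets `C_n(W)` in `0` or `2` endpoints. [folklore] -/
theorem forall_mem_clusterSet_of_pos {n : Current G} {W : Finset V} {e : G.edgeFinset} (he : 0 < n e)
    {v : V} (hv : v ∈ (e : Sym2 V)) (hvC : v ∈ n.clusterSet W) :
    ∀ u ∈ (e : Sym2 V), u ∈ n.clusterSet W := by
  obtain ⟨s, hs, hvC⟩ := mem_clusterSet_iff.1 hvC
  intro u hu
  exact mem_clusterSet_iff.2 ⟨s, hs, forall_mem_cluster_of_pos he hv hvC u hu⟩

/-- **Currents vanish on the edges leaving `C_m(W)`**: if `C_m(W) = T`, `a ∈ T`, `b ∉ T` then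
`m_{ab} = 0`. [folklore] -/
theorem apply_eq_zero_of_clusterSet_eq {m : Current G} {W T : Finset V} (hT : m.clusterSet W = T)
    {e : G.edgeFinset} {a b : V} (he : (e : Sym2 V) = s(a, b)) (ha : a ∈ T) (hb : b ∉ T) : m e = 0 := by
  by_contra hne
  have hpos : 0 < m e := Nat.pos_of_ne_zero hne
  have ha' : a ∈ (e : Sym2 V) := by rw [he]; exact Sym2.mem_mk_left a b
  have hb' : b ∈ (e : Sym2 V) := by rw [he]; exact Sym2.mem_mk_right a b
  exact hb (hT ▸ forall_mem_clusterSet_of_pos hpos ha' (hT.symm ▸ ha) b hb')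

/-- **Locality of `C(W)`**: if `m'` agrees with `m` on every edge meeting `T = C_m(W)` then
`C_{m'}(W) = T`. [folklore] -/
theorem clusterSet_eq_of_agree {m m' : Current G} {W T : Finset V} (hT : m.clusterSet W = T)
    (hagree : ∀ e : G.edgeFinset, ¬ EdgeOff T (e : Sym2 V) → m' e = m e) : m'.clusterSet W = T := by
  have hs : ∀ s ∈ W, m'.cluster s = m.cluster s := by
    intro s hs
    have hsub : m.cluster s ⊆ T := hT ▸ cluster_subset_clusterSet m hs
    refine cluster_eq_of_agree rfl fun e he => hagree e fun hoff => he ?_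
    intro v hv hvC
    exact hoff v hv (hsub hvC)
  rw [← hT]
  unfold clusterSet
  exact Finset.biUnion_congr rfl hs

/-- **A current splits along `C_N(W)`** for every `n ≤ N`: `n = n|_C + n|_{Cᶜ}`, `C = C_N(W)`.
[folklore] -/
theorem eq_restrictTo_add_restrictTo_compl_set {n N : Current G} (hle : n ≤ N) (W : Finset V) :
    n = restrictTo (N.clusterSet W) n + restrictTo (N.clusterSet W)ᶜ n := by
  funext e
  simp only [Pi.add_apply, restrictTo]
  rcases Nat.eq_zero_or_pos (n e) with h0 | hpos
  · simp [h0]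
  · have hposN : 0 < N e := lt_of_lt_of_le hpos (hle e)
    by_cases hin : ∀ v ∈ (e : Sym2 V), v ∈ N.clusterSet W
    · have hout : ¬∀ v ∈ (e : Sym2 V), v ∈ (N.clusterSet W)ᶜ := by
        intro h
        obtain ⟨e', he'⟩ := e
        induction e' using Sym2.ind with
        | _ a b =>
          exact (Finset.mem_compl.1 (h a (Sym2.mem_mk_left a b))) (hin a (Sym2.mem_mk_left a b))
      rw [if_pos hin, if_neg hout, add_zero]
    · have hout : ∀ v ∈ (e : Sym2 V), v ∈ (N.clusterSet W)ᶜ := by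
        intro v hv
        rw [Finset.mem_compl]
        intro hvC
        exact hin (forall_mem_clusterSet_of_pos hposN hv hvC)
      rw [if_neg hin, if_pos hout, zero_add]

/-- **The set cluster of the recombined current**: if `m` lives in `B` with `C_m(W) = B` and `k` is
supported off `B` then `C_{m+k}(W) = B`. [folklore] -/
theorem clusterSet_add_eq_of_isSupp {B W : Finset V} {m k : Current G} (hm : IsSupp (offGraph G Bᶜ) m)
    (hk : IsSupp (offGraph G B) k) (hms : m.clusterSet W = B) : (m + k).clusterSet W = B := by
  have hWB : W ⊆ B := hms ▸ subset_clusterSet m W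
  ext v
  rw [← hms, mem_clusterSet_iff, mem_clusterSet_iff]
  constructor
  · rintro ⟨s, hs, hv⟩
    refine ⟨s, hs, ?_⟩
    rw [mem_cluster_iff] at hv ⊢
    exact (reachable_add_iff_left_of_isSupp hm hk (hWB hs) v).1 hv
  · rintro ⟨s, hs, hv⟩
    refine ⟨s, hs, ?_⟩
    rw [mem_cluster_iff] at hv ⊢
    exact (reachable_add_iff_left_of_isSupp hm hk (hWB hs) v).2 hv

/-- Restriction is monotone in the vertex set. [folklore] -/
theorem restrictTo_mono_set {W W' : Finset V} (h : W ⊆ W') (n : Current G) :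
    restrictTo W n ≤ restrictTo W' n := by
  intro e
  unfold restrictTo
  by_cases he : ∀ v ∈ (e : Sym2 V), v ∈ W
  · rw [if_pos he, if_pos fun v hv => h (he v hv)]
  · rw [if_neg he]; exact Nat.zero_le _

/-- **The set cluster of the inside part**: `C_{n|_C}(W) = C` for `C = C_n(W)`. [folklore] -/
theorem clusterSet_restrictTo (n : Current G) (W : Finset V) :
    (restrictTo (n.clusterSet W) n).clusterSet W = n.clusterSet W := by
  refine Finset.Subset.antisymm (clusterSet_mono (restrictTo_le _ _) W) ?_
  intro v hv
  obtain ⟨s, hs, hv⟩ := mem_clusterSet_iff.1 hv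
  refine mem_clusterSet_iff.2 ⟨s, hs, ?_⟩
  have h1 : v ∈ (restrictTo (n.cluster s) n).cluster s := by rw [cluster_restrictTo_cluster]; exact hv
  exact cluster_mono (restrictTo_mono_set (cluster_subset_clusterSet n hs) n) s h1

/-! ### The decoupling identity across the cluster of a set -/

/-- **Decoupling across the cluster of a vertex set** (the set version of the tree's
`Current.tsum_pair_eq_sum_cluster`): for `K ≥ 0`, a vertex set `W` and any `Φ ≥ 0` on pairs of
currents, the weighted sum over pairs `(n₁,n₂)` equals the sum over the value `B` of `C_{n₁+n₂}(W)`
of the sum over inside pairs `(m₁,m₂)` living in `B` with `C_{m₁+m₂}(W) = B` and outside pairs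
`(k₁,k₂)` supported off `B`, of `w(m₁)w(m₂)w(k₁)w(k₂) Φ(m₁+k₁, m₂+k₂)`. [cite: AizenmanDuminilCopinAnnals2021, arXiv:1912.07973 Appendix A.1, proof of Lemma A.1 ("n₂ be decomposed into the current m on T and a current n₂' outside T")] -/
theorem tsum_pair_eq_sum_clusterSet {K : G.edgeFinset → ℝ} (hK : ∀ e, 0 ≤ K e) (W : Finset V)
    (Φ : Current G × Current G → ℝ≥0∞) :
    ∑' p : Current G × Current G, p.1.eweight K * p.2.eweight K * Φ p =
      ∑ B : Finset V, ∑' q : (Current G × Current G) × (Current G × Current G),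
        (if IsSupp (offGraph G Bᶜ) q.1.1 ∧ IsSupp (offGraph G Bᶜ) q.1.2 ∧
            (q.1.1 + q.1.2).clusterSet W = B then eweight K q.1.1 * eweight K q.1.2 else 0) *
        (if IsSupp (offGraph G B) q.2.1 ∧ IsSupp (offGraph G B) q.2.2
            then eweight K q.2.1 * eweight K q.2.2 else 0) *
        Φ (q.1.1 + q.2.1, q.1.2 + q.2.2) := by
  classical
  -- Step 1: insert `1 = ∑_B 𝟙[C(W) = B]` and exchange the sums
  set f : Finset V → Current G × Current G → ℝ≥0∞ := fun B p =>
    if (p.1 + p.2).clusterSet W = B then eweight K p.1 * eweight K p.2 * Φ p else 0 with hf_def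
  have h1 : ∀ p : Current G × Current G,
      eweight K p.1 * eweight K p.2 * Φ p = ∑ B : Finset V, f B p := by
    intro p
    simp only [hf_def]
    rw [Finset.sum_ite_eq Finset.univ ((p.1 + p.2).clusterSet W), if_pos (Finset.mem_univ _)]
  simp_rw [h1]
  rw [Summable.tsum_finsetSum (fun B _ => ENNReal.summable)]
  refine Finset.sum_congr rfl fun B _ => ?_
  -- Step 2: for fixed `B`, reindex by `(m, k) ↦ m + k`
  set g : (Current G × Current G) × (Current G × Current G) → ℝ≥0∞ := fun q =>
    (if IsSupp (offGraph G Bᶜ) q.1.1 ∧ IsSupp (offGraph G Bᶜ) q.1.2 ∧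
        (q.1.1 + q.1.2).clusterSet W = B then eweight K q.1.1 * eweight K q.1.2 else 0) *
    (if IsSupp (offGraph G B) q.2.1 ∧ IsSupp (offGraph G B) q.2.2
        then eweight K q.2.1 * eweight K q.2.2 else 0) *
    Φ (q.1.1 + q.2.1, q.1.2 + q.2.2) with hg_def
  change ∑' p, f B p = ∑' q, g q
  have hsupp : ∀ q, g q ≠ 0 → (IsSupp (offGraph G Bᶜ) q.1.1 ∧ IsSupp (offGraph G Bᶜ) q.1.2 ∧
      (q.1.1 + q.1.2).clusterSet W = B) ∧ (IsSupp (offGraph G B) q.2.1 ∧ IsSupp (offGraph G B) q.2.2) := by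
    intro q hq
    simp only [hg_def] at hq
    by_cases hin : IsSupp (offGraph G Bᶜ) q.1.1 ∧ IsSupp (offGraph G Bᶜ) q.1.2 ∧
        (q.1.1 + q.1.2).clusterSet W = B
    · by_cases hout : IsSupp (offGraph G B) q.2.1 ∧ IsSupp (offGraph G B) q.2.2
      · exact ⟨hin, hout⟩
      · rw [if_neg hout] at hq; simp at hq
    · rw [if_neg hin] at hq; simp at hq
  have hgval : ∀ q, g q ≠ 0 → g q = eweight K q.1.1 * eweight K q.1.2 *
      (eweight K q.2.1 * eweight K q.2.2) * Φ (q.1.1 + q.2.1, q.1.2 + q.2.2) := by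
    intro q hq
    obtain ⟨hin, hout⟩ := hsupp q hq
    simp only [hg_def, if_pos hin, if_pos hout]
  set i : Function.support g → Current G × Current G := fun q =>
    (q.1.1.1 + q.1.2.1, q.1.1.2 + q.1.2.2) with hi_def
  refine tsum_eq_tsum_of_ne_zero_bij i ?_ ?_ ?_
  · -- injectivity: the parts are recovered as restrictions
    rintro ⟨q, hq⟩ ⟨q', hq'⟩ h
    obtain ⟨⟨hq11, hq12, -⟩, hq21, hq22⟩ := hsupp q hq
    obtain ⟨⟨hq11', hq12', -⟩, hq21', hq22'⟩ := hsupp q' hq'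
    simp only [hi_def, Prod.mk.injEq] at h
    obtain ⟨ha, hb⟩ := h
    have e11 : q.1.1 = q'.1.1 := by
      rw [← restrictTo_add_of_isSupp hq11 hq21, ha, restrictTo_add_of_isSupp hq11' hq21']
    have e21 : q.2.1 = q'.2.1 := by
      rw [← restrictTo_compl_add_of_isSupp hq11 hq21, ha, restrictTo_compl_add_of_isSupp hq11' hq21']
    have e12 : q.1.2 = q'.1.2 := by
      rw [← restrictTo_add_of_isSupp hq12 hq22, hb, restrictTo_add_of_isSupp hq12' hq22']
    have e22 : q.2.2 = q'.2.2 := by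
      rw [← restrictTo_compl_add_of_isSupp hq12 hq22, hb, restrictTo_compl_add_of_isSupp hq12' hq22']
    exact Subtype.ext (Prod.ext (Prod.ext e11 e12) (Prod.ext e21 e22))
  · -- the range covers the support of `f B`
    intro p hp
    rw [Function.mem_support] at hp
    simp only [hf_def] at hp
    by_cases hC : (p.1 + p.2).clusterSet W = B
    swap
    · rw [if_neg hC] at hp; exact absurd rfl hp
    rw [if_pos hC] at hp
    set m₁ := restrictTo B p.1
    set m₂ := restrictTo B p.2
    set k₁ := restrictTo Bᶜ p.1
    set k₂ := restrictTo Bᶜ p.2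
    have hm₁ : IsSupp (offGraph G Bᶜ) m₁ := isSupp_restrictTo _ _
    have hm₂ : IsSupp (offGraph G Bᶜ) m₂ := isSupp_restrictTo _ _
    have hk₁ : IsSupp (offGraph G B) k₁ := isSupp_offGraph_restrictTo_compl _ _
    have hk₂ : IsSupp (offGraph G B) k₂ := isSupp_offGraph_restrictTo_compl _ _
    have hp1 : p.1 = m₁ + k₁ := by
      have := eq_restrictTo_add_restrictTo_compl_set (le_self_add : p.1 ≤ p.1 + p.2) W
      rwa [hC] at this
    have hp2 : p.2 = m₂ + k₂ := by
      have := eq_restrictTo_add_restrictTo_compl_set (le_add_self : p.2 ≤ p.1 + p.2) W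
      rwa [hC] at this
    have hclm : (m₁ + m₂).clusterSet W = B := by
      have : m₁ + m₂ = restrictTo B (p.1 + p.2) := (restrictTo_add B p.1 p.2).symm
      rw [this, ← hC, clusterSet_restrictTo]
    set q : (Current G × Current G) × (Current G × Current G) := ((m₁, m₂), (k₁, k₂)) with hq
    have hgq : g q = eweight K p.1 * eweight K p.2 * Φ p :=
      calc g q = eweight K m₁ * eweight K m₂ * (eweight K k₁ * eweight K k₂) * Φ (m₁ + k₁, m₂ + k₂) := by
            simp only [hg_def, hq, if_pos (And.intro hm₁ (And.intro hm₂ hclm)), if_pos (And.intro hk₁ hk₂)]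
        _ = eweight K (m₁ + k₁) * eweight K (m₂ + k₂) * Φ (m₁ + k₁, m₂ + k₂) := by
            rw [eweight_add_of_isSupp hK hm₁ hk₁, eweight_add_of_isSupp hK hm₂ hk₂]; ring
        _ = eweight K p.1 * eweight K p.2 * Φ p := by rw [← hp1, ← hp2, Prod.mk.eta]
    have hgq0 : g q ≠ 0 := by rw [hgq]; exact hp
    refine ⟨⟨q, hgq0⟩, ?_⟩
    simp only [hi_def, hq]
    rw [← hp1, ← hp2]
  · -- values agree
    rintro ⟨q, hq⟩
    obtain ⟨⟨hq11, hq12, hcl⟩, hq21, hq22⟩ := hsupp q hq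
    rw [hgval q hq]
    simp only [hi_def, hf_def]
    have hsum : q.1.1 + q.2.1 + (q.1.2 + q.2.2) = (q.1.1 + q.1.2) + (q.2.1 + q.2.2) := by abel
    have hcl' : (q.1.1 + q.2.1 + (q.1.2 + q.2.2)).clusterSet W = B := by
      rw [hsum]
      exact clusterSet_add_eq_of_isSupp (isSupp_add hq11 hq12) (isSupp_add hq21 hq22) hcl
    rw [if_pos hcl', eweight_add_of_isSupp hK hq11 hq21, eweight_add_of_isSupp hK hq12 hq22]
    ring

/-! ### Lemma A.1 for the cluster of a set -/

variable {K : G.edgeFinset → ℝ}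

/-- The inner sum at a frozen set cluster `C_{n₁+n₂}(W) = T`: over inside pairs `(m₁, m₂)` living in
`T` with `C_{m₁+m₂}(W) = T`, `∂m₂ = ∅`, and first outside parts `k₁` supported off `T`, of
`w(m₁) w(m₂) w(k₁) 1{∂(m₁+k₁) = A} F(m₁+k₁, m₂)`. [folklore] -/
def clusterSetInner (K : G.edgeFinset → ℝ) (W : Finset V) (A : Finset V)
    (F : Current G × Current G → ℝ≥0∞) (T : Finset V) (r : (Current G × Current G) × Current G) : ℝ≥0∞ :=
  (if IsSupp (offGraph G Tᶜ) r.1.1 ∧ IsSupp (offGraph G Tᶜ) r.1.2 ∧ (r.1.1 + r.1.2).clusterSet W = T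
      then r.1.1.eweight K * r.1.2.eweight K else 0) *
    (if IsSupp (offGraph G T) r.2 then r.2.eweight K else 0) *
    ((if (r.1.1 + r.2).sources = A then 1 else 0) * (if r.1.2.sources = ∅ then 1 else 0) *
      F (r.1.1 + r.2, r.1.2))

/-- **Conditioning on the cluster of a set** (the computation in the proof of Aizenman–Duminil-Copin
2021, Lemma A.1, with a cluster functional `ρ`): for `F` local in the second current and vanishing
when `∂n₁ = A`, `∂n₂ = D`, `F ≠ 0` would force `C ∩ D ≠ ∅`,
`∑ 1{∂n₁=A}1{∂n₂=D} w w F · ρ(C) = ∑_T (∑_r clusterSetInner T r) · ρ(T) · Z_{G∖T}[D]`,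
`C = C_{n₁+n₂}(W)`. [cite: AizenmanDuminilCopinAnnals2021, arXiv:1912.07973 Appendix A.1, Lemma A.1, proof] -/
theorem tsum_epairWeight_mul_eq_sum_clusterSet (hK : ∀ e, 0 ≤ K e) (W : Finset V) (A D : Finset V)
    (F : Current G × Current G → ℝ≥0∞) (ρ : Finset V → ℝ≥0∞)
    (hloc : ∀ n₁ n₂ n₂' : Current G,
      (∀ e : G.edgeFinset, ¬ EdgeOff ((n₁ + n₂).clusterSet W) (e : Sym2 V) → n₂' e = n₂ e) →
      F (n₁, n₂') = F (n₁, n₂))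
    (hvan : ∀ n₁ n₂ : Current G, n₁.sources = A → n₂.sources = D → F (n₁, n₂) ≠ 0 →
      Disjoint ((n₁ + n₂).clusterSet W) D) :
    ∑' p : Current G × Current G, epairWeight K A D p * (F p * ρ ((p.1 + p.2).clusterSet W)) =
      ∑ T : Finset V, (∑' r, clusterSetInner K W A F T r) * (ρ T * ecurrentSumIn (offGraph G T) K D) := by
  classical
  have h0 : (∑' p : Current G × Current G, epairWeight K A D p * (F p * ρ ((p.1 + p.2).clusterSet W))) =
      ∑' p : Current G × Current G, p.1.eweight K * p.2.eweight K *
        (fun p : Current G × Current G => (if p.1.sources = A then 1 else 0) *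
          (if p.2.sources = D then 1 else 0) * (F p * ρ ((p.1 + p.2).clusterSet W))) p :=
    tsum_congr fun p => epairWeight_mul_eq K A D p _
  rw [h0, tsum_pair_eq_sum_clusterSet hK W]
  refine Finset.sum_congr rfl fun T _ => ?_
  rw [← (Equiv.prodAssoc (Current G × Current G) (Current G) (Current G)).tsum_eq,
    ENNReal.tsum_prod', ← ENNReal.tsum_mul_right]
  refine tsum_congr fun r => ?_
  obtain ⟨⟨m₁, m₂⟩, k₁⟩ := r
  simp only [Equiv.prodAssoc_apply, clusterSetInner]
  by_cases hin : IsSupp (offGraph G Tᶜ) m₁ ∧ IsSupp (offGraph G Tᶜ) m₂ ∧ (m₁ + m₂).clusterSet W = T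
  swap
  · simp only [if_neg hin, zero_mul, tsum_zero]
  obtain ⟨hm₁, hm₂, hcl⟩ := hin
  rw [if_pos ⟨hm₁, hm₂, hcl⟩]
  by_cases hk₁ : IsSupp (offGraph G T) k₁
  swap
  · have h' : ∀ k₂ : Current G, ¬ (IsSupp (offGraph G T) k₁ ∧ IsSupp (offGraph G T) k₂) :=
      fun k₂ h => hk₁ h.1
    simp only [if_neg (h' _), if_neg hk₁, mul_zero, zero_mul, tsum_zero]
  rw [if_pos hk₁]
  have hclT : ∀ {k₂ : Current G}, IsSupp (offGraph G T) k₂ →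
      ((m₁ + k₁) + (m₂ + k₂)).clusterSet W = T := fun {k₂} hk₂ => by
    rw [add_add_add_comm]
    exact clusterSet_add_eq_of_isSupp (isSupp_add hm₁ hm₂) (isSupp_add hk₁ hk₂) hcl
  have hFT : ∀ {k₂ : Current G}, IsSupp (offGraph G T) k₂ →
      F (m₁ + k₁, m₂ + k₂) = F (m₁ + k₁, m₂) := fun {k₂} hk₂ => by
    refine (hloc (m₁ + k₁) (m₂ + k₂) m₂ fun e he => ?_).symm
    rw [hclT hk₂] at he
    rw [Pi.add_apply, (isSupp_offGraph_iff.1 hk₂) e he, add_zero]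
  by_cases hTD : Disjoint T D
  · have hsrc : ∀ {k₂ : Current G}, IsSupp (offGraph G T) k₂ →
        ((m₂ + k₂).sources = D ↔ m₂.sources = ∅ ∧ k₂.sources = D) := fun {k₂} hk₂ => by
      rw [sources_add_eq_iff_of_isSupp hm₂ hk₂ D, Finset.disjoint_iff_inter_eq_empty.1 hTD.symm,
        Finset.sdiff_eq_self_iff_disjoint.2 hTD.symm]
    rw [ecurrentSumIn, ← mul_assoc, ← ENNReal.tsum_mul_left]
    refine tsum_congr fun k₂ => ?_
    by_cases hk₂ : IsSupp (offGraph G T) k₂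
    · rw [if_pos ⟨hk₁, hk₂⟩, hFT hk₂, hclT hk₂]
      by_cases hD : (m₂ + k₂).sources = D
      · obtain ⟨hm₂s, hk₂s⟩ := (hsrc hk₂).1 hD
        rw [if_pos hD, if_pos hm₂s, if_pos (And.intro hk₂ hk₂s)]
        ring
      · rw [if_neg hD]
        by_cases hm₂s : m₂.sources = ∅
        · have hk₂s : ¬ (IsSupp (offGraph G T) k₂ ∧ k₂.sources = D) :=
            fun h => hD ((hsrc hk₂).2 ⟨hm₂s, h.2⟩)
          rw [if_neg hk₂s]
          simp only [mul_zero, zero_mul]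
        · rw [if_neg hm₂s]
          simp only [mul_zero, zero_mul]
    · have h1 : ¬ (IsSupp (offGraph G T) k₁ ∧ IsSupp (offGraph G T) k₂) := fun h => hk₂ h.2
      have h2 : ¬ (IsSupp (offGraph G T) k₂ ∧ k₂.sources = D) := fun h => hk₂ h.1
      rw [if_neg h1, if_neg h2]
      simp only [mul_zero, zero_mul]
  · rw [ecurrentSumIn_offGraph_eq_zero_of_not_disjoint hTD, mul_zero, mul_zero]
    refine ENNReal.tsum_eq_zero.2 fun k₂ => ?_
    by_cases hk₂ : IsSupp (offGraph G T) k₂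
    · by_cases hA : (m₁ + k₁).sources = A
      · by_cases hD : (m₂ + k₂).sources = D
        · have hF0 : F (m₁ + k₁, m₂ + k₂) = 0 := by
            by_contra hF0
            have hdis := hvan _ _ hA hD hF0
            rw [hclT hk₂] at hdis
            exact hTD hdis
          rw [hF0]
          simp only [mul_zero, zero_mul]
        · rw [if_neg hD]
          simp only [mul_zero, zero_mul]
      · rw [if_neg hA]
        simp only [mul_zero, zero_mul]
    · have h1 : ¬ (IsSupp (offGraph G T) k₁ ∧ IsSupp (offGraph G T) k₂) := fun h => hk₂ h.2
      rw [if_neg h1]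
      simp only [mul_zero, zero_mul]

/-- **Aizenman–Duminil-Copin 2021, Lemma A.1 (identity), for the cluster of a vertex set,
current-sum form.** For `K ≥ 0`, a vertex set `W` (the printed `S`), source sets `A, B`, and `F ≥ 0`
on pairs of currents which depends on the second current only through its values on the edges meeting
`C = C_{n₁+n₂}(W)` and vanishes when `∂n₁ = A`, `∂n₂ = B` and `C ∩ B ≠ ∅`:
`∑ 1{∂n₁=A} 1{∂n₂=B} w w F(n₁,n₂) = ∑ 1{∂n₁=A} 1{∂n₂=∅} w w F(n₁,n₂) · Z_{G∖C}[B]/Z_{G∖C}[∅]`,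
i.e. `E^{A,B}[F] = E^{A,∅}[F ⟨σ_B⟩_{Λ∖C_{n₁+n₂}(S)}/⟨σ_B⟩_Λ]` after division by `Z[A]Z[B]`.
[cite: AizenmanDuminilCopinAnnals2021, arXiv:1912.07973 Appendix A.1, Lemma A.1] -/
theorem tsum_epairWeight_eq_tsum_mul_offRatio_set (hK : ∀ e, 0 ≤ K e) (W : Finset V) (A B : Finset V)
    (F : Current G × Current G → ℝ≥0∞)
    (hloc : ∀ n₁ n₂ n₂' : Current G,
      (∀ e : G.edgeFinset, ¬ EdgeOff ((n₁ + n₂).clusterSet W) (e : Sym2 V) → n₂' e = n₂ e) →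
      F (n₁, n₂') = F (n₁, n₂))
    (hvan : ∀ n₁ n₂ : Current G, n₁.sources = A → n₂.sources = B → F (n₁, n₂) ≠ 0 →
      Disjoint ((n₁ + n₂).clusterSet W) B) :
    ∑' p : Current G × Current G, epairWeight K A B p * F p =
      ∑' p : Current G × Current G,
        epairWeight K A ∅ p * (F p * offRatio K ((p.1 + p.2).clusterSet W) B) := by
  have hL := tsum_epairWeight_mul_eq_sum_clusterSet hK W A B F (fun _ => 1) hloc hvan
  have hR := tsum_epairWeight_mul_eq_sum_clusterSet hK W A ∅ F (fun T => offRatio K T B) hloc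
    (fun _ _ _ _ _ => Finset.disjoint_empty_right _)
  simp only [mul_one, one_mul] at hL
  rw [hL, hR]
  refine Finset.sum_congr rfl fun T _ => ?_
  rw [offRatio_mul_ecurrentSumIn_empty hK]

/-- **Aizenman–Duminil-Copin 2021, Lemma A.1 (identity) for the cluster of a set, sources of the
first current.** The same identity with the roles of the two currents exchanged.
[cite: AizenmanDuminilCopinAnnals2021, arXiv:1912.07973 Appendix A.1, Lemma A.1] -/
theorem tsum_epairWeight_eq_tsum_mul_offRatio_set_left (hK : ∀ e, 0 ≤ K e) (W : Finset V)
    (A B : Finset V) (F : Current G × Current G → ℝ≥0∞)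
    (hloc : ∀ n₁ n₁' n₂ : Current G,
      (∀ e : G.edgeFinset, ¬ EdgeOff ((n₁ + n₂).clusterSet W) (e : Sym2 V) → n₁' e = n₁ e) →
      F (n₁', n₂) = F (n₁, n₂))
    (hvan : ∀ n₁ n₂ : Current G, n₁.sources = A → n₂.sources = B → F (n₁, n₂) ≠ 0 →
      Disjoint ((n₁ + n₂).clusterSet W) A) :
    ∑' p : Current G × Current G, epairWeight K A B p * F p =
      ∑' p : Current G × Current G,
        epairWeight K ∅ B p * (F p * offRatio K ((p.1 + p.2).clusterSet W) A) := by
  have h := tsum_epairWeight_eq_tsum_mul_offRatio_set hK W B A (fun p => F p.swap)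
    (fun n₁ n₂ n₂' hag => hloc n₂ n₂' n₁ (fun e he => hag e (by rwa [add_comm])))
    (fun n₁ n₂ h₁ h₂ hF => by rw [add_comm]; exact hvan n₂ n₁ h₂ h₁ hF)
  rw [← (Equiv.prodComm (Current G) (Current G)).tsum_eq] at h
  conv at h => rhs; rw [← (Equiv.prodComm (Current G) (Current G)).tsum_eq]
  simp only [Equiv.prodComm_apply, Prod.swap_swap, epairWeight_swap, Prod.fst_swap,
    Prod.snd_swap] at h
  simpa only [add_comm] using h

/-- **Aizenman–Duminil-Copin 2021, Lemma A.1 (inequality) for the cluster of a set, pair case.**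
Under the hypotheses of `tsum_epairWeight_eq_tsum_mul_offRatio_set` with `B = {a,b}`:
`Z[∅] · ∑ 1{∂n₁=A}1{∂n₂={a,b}} w w F ≤ Z[{a,b}] · ∑ 1{∂n₁=A}1{∂n₂=∅} w w F`
("The second inequality is a trivial application of Griffiths' inequality").
[cite: AizenmanDuminilCopinAnnals2021, arXiv:1912.07973 Appendix A.1, Lemma A.1] -/
theorem ecurrentSum_empty_mul_tsum_epairWeight_pair_le_set (hK : ∀ e, 0 ≤ K e) (W : Finset V)
    (A : Finset V) (a b : V) (F : Current G × Current G → ℝ≥0∞)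
    (hloc : ∀ n₁ n₂ n₂' : Current G,
      (∀ e : G.edgeFinset, ¬ EdgeOff ((n₁ + n₂).clusterSet W) (e : Sym2 V) → n₂' e = n₂ e) →
      F (n₁, n₂') = F (n₁, n₂))
    (hvan : ∀ n₁ n₂ : Current G, n₁.sources = A → n₂.sources = {a} ∆ {b} → F (n₁, n₂) ≠ 0 →
      Disjoint ((n₁ + n₂).clusterSet W) ({a} ∆ {b})) :
    ecurrentSum K ∅ * ∑' p : Current G × Current G, epairWeight K A ({a} ∆ {b}) p * F p ≤
      ecurrentSum K ({a} ∆ {b}) * ∑' p : Current G × Current G, epairWeight K A ∅ p * F p := by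
  rw [tsum_epairWeight_eq_tsum_mul_offRatio_set hK W A ({a} ∆ {b}) F hloc hvan, ← ENNReal.tsum_mul_left,
    ← ENNReal.tsum_mul_left]
  refine ENNReal.tsum_le_tsum fun p => ?_
  calc ecurrentSum K ∅ * (epairWeight K A ∅ p * (F p * offRatio K ((p.1 + p.2).clusterSet W) ({a} ∆ {b})))
      = epairWeight K A ∅ p * F p * (offRatio K ((p.1 + p.2).clusterSet W) ({a} ∆ {b}) * ecurrentSum K ∅) := by
        ring
    _ ≤ epairWeight K A ∅ p * F p * ecurrentSum K ({a} ∆ {b}) :=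
        mul_le_mul' le_rfl (offRatio_pair_mul_le hK _ a b)
    _ = ecurrentSum K ({a} ∆ {b}) * (epairWeight K A ∅ p * F p) := by ring

/-- **Lemma A.1 (inequality) for the cluster of a set, pair case, sources of the first current.**
`Z[∅] · ∑ 1{∂n₁={a,b}}1{∂n₂=B} w w F ≤ Z[{a,b}] · ∑ 1{∂n₁=∅}1{∂n₂=B} w w F` for `F` local in the
first current and vanishing when `C_{n₁+n₂}(W)` meets `{a,b}`.
[cite: AizenmanDuminilCopinAnnals2021, arXiv:1912.07973 Appendix A.1, Lemma A.1] -/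
theorem ecurrentSum_empty_mul_tsum_epairWeight_pair_le_set_left (hK : ∀ e, 0 ≤ K e) (W : Finset V)
    (B : Finset V) (a b : V) (F : Current G × Current G → ℝ≥0∞)
    (hloc : ∀ n₁ n₁' n₂ : Current G,
      (∀ e : G.edgeFinset, ¬ EdgeOff ((n₁ + n₂).clusterSet W) (e : Sym2 V) → n₁' e = n₁ e) →
      F (n₁', n₂) = F (n₁, n₂))
    (hvan : ∀ n₁ n₂ : Current G, n₁.sources = {a} ∆ {b} → n₂.sources = B → F (n₁, n₂) ≠ 0 →
      Disjoint ((n₁ + n₂).clusterSet W) ({a} ∆ {b})) :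
    ecurrentSum K ∅ * ∑' p : Current G × Current G, epairWeight K ({a} ∆ {b}) B p * F p ≤
      ecurrentSum K ({a} ∆ {b}) * ∑' p : Current G × Current G, epairWeight K ∅ B p * F p := by
  rw [tsum_epairWeight_eq_tsum_mul_offRatio_set_left hK W ({a} ∆ {b}) B F hloc hvan,
    ← ENNReal.tsum_mul_left, ← ENNReal.tsum_mul_left]
  refine ENNReal.tsum_le_tsum fun p => ?_
  calc ecurrentSum K ∅ * (epairWeight K ∅ B p * (F p * offRatio K ((p.1 + p.2).clusterSet W) ({a} ∆ {b})))
      = epairWeight K ∅ B p * F p * (offRatio K ((p.1 + p.2).clusterSet W) ({a} ∆ {b}) * ecurrentSum K ∅) := by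
        ring
    _ ≤ epairWeight K ∅ B p * F p * ecurrentSum K ({a} ∆ {b}) :=
        mul_le_mul' le_rfl (offRatio_pair_mul_le hK _ a b)
    _ = ecurrentSum K ({a} ∆ {b}) * (epairWeight K ∅ B p * F p) := by ring

/-! ### Remark A.5: inserting a pair of sources at `u` increases `P[u ↔ T]` -/

/-- The indicator `𝟙[C_{n₁+n₂}(u) ∩ T = ∅]` of the event "`u` is not connected to the set `T`".
[cite: AizenmanDuminilCopinAnnals2021, arXiv:1912.07973 Appendix A.2, Remark A.5 (the event 0 ↔ S)] -/
def avoidSetInd (u : V) (T : Finset V) (p : Current G × Current G) : ℝ≥0∞ :=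
  if Disjoint ((p.1 + p.2).cluster u) T then 1 else 0

/-- `u ↮ T` iff `u ∉ C(T)`. [folklore] -/
theorem disjoint_cluster_iff_not_mem_clusterSet {n : Current G} {u : V} {T : Finset V} :
    Disjoint (n.cluster u) T ↔ u ∉ n.clusterSet T := by
  rw [mem_clusterSet_iff, Finset.disjoint_right]
  constructor
  · rintro h ⟨s, hs, hu⟩
    exact h hs ((mem_cluster_comm).1 hu)
  · intro h s hs hsu
    exact h ⟨s, hs, (mem_cluster_comm).1 hsu⟩

/-- `avoidSetInd` as the indicator of `u ∉ C_{n₁+n₂}(T)`. [folklore] -/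
theorem avoidSetInd_eq (u : V) (T : Finset V) (p : Current G × Current G) :
    avoidSetInd u T p = if u ∈ (p.1 + p.2).clusterSet T then 0 else 1 := by
  unfold avoidSetInd
  by_cases h : u ∈ (p.1 + p.2).clusterSet T
  · rw [if_neg (fun hd => (disjoint_cluster_iff_not_mem_clusterSet.1 hd) h), if_pos h]
  · rw [if_pos (disjoint_cluster_iff_not_mem_clusterSet.2 h), if_neg h]

/-- `avoidSetInd ≤ 1`. [folklore] -/
theorem avoidSetInd_le_one (u : V) (T : Finset V) (p : Current G × Current G) : avoidSetInd u T p ≤ 1 := by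
  unfold avoidSetInd; split_ifs <;> simp

/-- Locality of `avoidSetInd` in the second current: it only depends on the edges meeting
`C_{n₁+n₂}(T)`. [folklore] -/
theorem avoidSetInd_local_right (u : V) (T : Finset V) (n₁ n₂ n₂' : Current G)
    (hag : ∀ e : G.edgeFinset, ¬ EdgeOff ((n₁ + n₂).clusterSet T) (e : Sym2 V) → n₂' e = n₂ e) :
    avoidSetInd u T (n₁, n₂') = avoidSetInd u T (n₁, n₂) := by
  have hcl : (n₁ + n₂').clusterSet T = (n₁ + n₂).clusterSet T :=
    clusterSet_eq_of_agree rfl fun e he => by rw [Pi.add_apply, Pi.add_apply, hag e he]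
  rw [avoidSetInd_eq, avoidSetInd_eq]
  simp only [hcl]

/-- Locality of `avoidSetInd` in the first current. [folklore] -/
theorem avoidSetInd_local_left (u : V) (T : Finset V) (n₁ n₁' n₂ : Current G)
    (hag : ∀ e : G.edgeFinset, ¬ EdgeOff ((n₁ + n₂).clusterSet T) (e : Sym2 V) → n₁' e = n₁ e) :
    avoidSetInd u T (n₁', n₂) = avoidSetInd u T (n₁, n₂) := by
  have hcl : (n₁' + n₂).clusterSet T = (n₁ + n₂).clusterSet T :=
    clusterSet_eq_of_agree rfl fun e he => by rw [Pi.add_apply, Pi.add_apply, hag e he]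
  rw [avoidSetInd_eq, avoidSetInd_eq]
  simp only [hcl]

/-- **The vanishing condition of Lemma A.1 for Remark A.5**: if `u ∉ C_{n₁+n₂}(T)` and
`∂n₂ = {u,a}` then `C_{n₁+n₂}(T)` misses `{u,a}` — were `a ∈ C(T)`, the path `u ↔ a` of `n₂` would put
`u` in `C(T)`. [cite: AizenmanDuminilCopinAnnals2021, arXiv:1912.07973 Appendix A.2, proof of Prop. A.3 ("apply Lemma A.1 to F(n₁,n₂) := 𝟙[u ↮ v]")] -/
theorem disjoint_clusterSet_pair_of_avoid {n₁ n₂ : Current G} {u a : V} {T : Finset V}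
    (hs : n₂.sources = {u} ∆ {a}) (hu : u ∉ (n₁ + n₂).clusterSet T) :
    Disjoint ((n₁ + n₂).clusterSet T) ({u} ∆ {a}) := by
  rw [Finset.disjoint_right]
  intro v hv hvC
  rcases eq_or_eq_of_mem_symmDiff_singleton hv with rfl | rfl
  · exact hu hvC
  · -- `v = a ∈ C(T)` and `u ∈ C_{n₂}(a)` give `u ∈ C(T)`
    obtain ⟨s, hsT, has⟩ := mem_clusterSet_iff.1 hvC
    have hua : u ∈ (n₁ + n₂).cluster v :=
      cluster_mono (le_add_self : n₂ ≤ n₁ + n₂) v ((mem_cluster_comm).1 (mem_cluster_of_sources_eq hs))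
    exact hu (mem_clusterSet_iff.2 ⟨s, hsT, mem_cluster_trans has hua⟩)

/-- The same with the sources `{u,a}` on the first current. [folklore] -/
theorem disjoint_clusterSet_pair_of_avoid_left {n₁ n₂ : Current G} {u a : V} {T : Finset V}
    (hs : n₁.sources = {u} ∆ {a}) (hu : u ∉ (n₁ + n₂).clusterSet T) :
    Disjoint ((n₁ + n₂).clusterSet T) ({u} ∆ {a}) := by
  have h := disjoint_clusterSet_pair_of_avoid (n₁ := n₂) (n₂ := n₁) (T := T) hs (by rwa [add_comm])
  rwa [add_comm] at h

/-- **Aizenman–Duminil-Copin 2021, Remark A.5 (first inequality), current-sum form, sources inserted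
on the second current.** For `K ≥ 0`, vertices `u, a`, any source set `A` of the first current and
any vertex set `T`:
`Z[∅] · ∑ 1{∂n₁=A}1{∂n₂={u,a}} w w 𝟙[C_{n₁+n₂}(u) ∩ T = ∅] ≤ Z[{u,a}] · ∑ 1{∂n₁=A}1{∂n₂=∅} w w 𝟙[C_{n₁+n₂}(u) ∩ T = ∅]`,
i.e. `P^{A,ua}[u ↮ T] ≤ P^{A,∅}[u ↮ T]`, equivalently the printed `P^{0x,∅}[0 ↔ S] ≤ P^{0x,0y}[0 ↔ S]`
(with `u = 0`, `A = {0,x}`, `a = y`, `T = S`): inserting a pair of sources at `u` can only help `u`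
reach `T`. Lemma A.1 for the cluster of the set `T` with `F = 𝟙[u ∉ C_{n₁+n₂}(T)]`.
[cite: AizenmanDuminilCopinAnnals2021, arXiv:1912.07973 Appendix A.2, Remark A.5 (first inequality)] -/
theorem ecurrentSum_empty_mul_tsum_avoidSet_le (hK : ∀ e, 0 ≤ K e) (A : Finset V) (u a : V)
    (T : Finset V) :
    ecurrentSum K ∅ * ∑' p : Current G × Current G, epairWeight K A ({u} ∆ {a}) p * avoidSetInd u T p ≤
      ecurrentSum K ({u} ∆ {a}) * ∑' p : Current G × Current G, epairWeight K A ∅ p * avoidSetInd u T p := by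
  refine ecurrentSum_empty_mul_tsum_epairWeight_pair_le_set hK T A u a (avoidSetInd u T)
    (fun n₁ n₂ n₂' hag => avoidSetInd_local_right u T n₁ n₂ n₂' hag) ?_
  intro n₁ n₂ _ h₂ hF
  refine disjoint_clusterSet_pair_of_avoid h₂ ?_
  intro hu
  rw [avoidSetInd_eq] at hF
  exact hF (if_pos hu)

/-- **Remark A.5 (first inequality), sources inserted on the first current.**
`Z[∅] · ∑ 1{∂n₁={u,a}}1{∂n₂=B} w w 𝟙[C_{n₁+n₂}(u) ∩ T = ∅] ≤ Z[{u,a}] · ∑ 1{∂n₁=∅}1{∂n₂=B} w w 𝟙[C_{n₁+n₂}(u) ∩ T = ∅]`.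
[cite: AizenmanDuminilCopinAnnals2021, arXiv:1912.07973 Appendix A.2, Remark A.5 (first inequality)] -/
theorem ecurrentSum_empty_mul_tsum_avoidSet_le_left (hK : ∀ e, 0 ≤ K e) (B : Finset V) (u a : V)
    (T : Finset V) :
    ecurrentSum K ∅ * ∑' p : Current G × Current G, epairWeight K ({u} ∆ {a}) B p * avoidSetInd u T p ≤
      ecurrentSum K ({u} ∆ {a}) * ∑' p : Current G × Current G, epairWeight K ∅ B p * avoidSetInd u T p := by
  refine ecurrentSum_empty_mul_tsum_epairWeight_pair_le_set_left hK T B u a (avoidSetInd u T)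
    (fun n₁ n₁' n₂ hag => avoidSetInd_local_left u T n₁ n₁' n₂ hag) ?_
  intro n₁ n₂ h₁ _ hF
  refine disjoint_clusterSet_pair_of_avoid_left h₁ ?_
  intro hu
  rw [avoidSetInd_eq] at hF
  exact hF (if_pos hu)

/-! ### Corollary A.2, second inequality: source insertion and the four-current intersection -/

/-- The indicator `𝟙[C_p(u) ∩ C_q(u) ∩ T = ∅]` of "the two clusters of `u` do not meet inside `T`"
(the complement of the event of Aizenman–Duminil-Copin 2021, Cor. A.2, second display; with `T` a
union of annuli around `u`, the event `B_S` of the proof of Prop. 4.3/6.1).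
[cite: AizenmanDuminilCopinAnnals2021, arXiv:1912.07973 Appendix A.1, Cor. A.2 (second inequality); §4.2, proof of Prop. 4.3 (event B_S)] -/
def fourAvoidInd (u : V) (T : Finset V) (pq : (Current G × Current G) × (Current G × Current G)) : ℝ≥0∞ :=
  if Disjoint ((pq.1.1 + pq.1.2).cluster u ∩ (pq.2.1 + pq.2.2).cluster u) T then 1 else 0

/-- Freezing the second pair: `𝟙[C_p(u) ∩ C_q(u) ∩ T = ∅] = 𝟙[C_p(u) ∩ (C_q(u) ∩ T) = ∅]`
("conditioning on `n₂+n₄`, the proposition applied to `𝐒 := C_{n₂+n₄}(0) ∩ S`"). [cite: AizenmanDuminilCopinAnnals2021, arXiv:1912.07973 Appendix A.1, proof of Cor. A.2] -/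
theorem fourAvoidInd_eq_avoidSetInd_fst (u : V) (T : Finset V)
    (pq : (Current G × Current G) × (Current G × Current G)) :
    fourAvoidInd u T pq = avoidSetInd u ((pq.2.1 + pq.2.2).cluster u ∩ T) pq.1 := by
  unfold fourAvoidInd avoidSetInd
  have : Disjoint ((pq.1.1 + pq.1.2).cluster u ∩ (pq.2.1 + pq.2.2).cluster u) T ↔
      Disjoint ((pq.1.1 + pq.1.2).cluster u) ((pq.2.1 + pq.2.2).cluster u ∩ T) := by
    simp only [Finset.disjoint_left, Finset.mem_inter]
    tauto
  simp only [this]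

/-- Freezing the first pair: `𝟙[C_p(u) ∩ C_q(u) ∩ T = ∅] = 𝟙[C_q(u) ∩ (C_p(u) ∩ T) = ∅]`
("Similarly, conditioning on `n₁+n₃`, the proposition applied to `𝐒' := C_{n₁+n₃}(0) ∩ S`").
[cite: AizenmanDuminilCopinAnnals2021, arXiv:1912.07973 Appendix A.1, proof of Cor. A.2] -/
theorem fourAvoidInd_eq_avoidSetInd_snd (u : V) (T : Finset V)
    (pq : (Current G × Current G) × (Current G × Current G)) :
    fourAvoidInd u T pq = avoidSetInd u ((pq.1.1 + pq.1.2).cluster u ∩ T) pq.2 := by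
  unfold fourAvoidInd avoidSetInd
  have : Disjoint ((pq.1.1 + pq.1.2).cluster u ∩ (pq.2.1 + pq.2.2).cluster u) T ↔
      Disjoint ((pq.2.1 + pq.2.2).cluster u) ((pq.1.1 + pq.1.2).cluster u ∩ T) := by
    simp only [Finset.disjoint_left, Finset.mem_inter]
    tauto
  simp only [this]

/-- The four-current mass of the avoidance event, `M^{A₁,B₁;A₂,B₂}[C_{n₁+n₃}(u) ∩ C_{n₂+n₄}(u) ∩ T = ∅]
= ∑ 1{∂n₁=A₁}1{∂n₃=B₁} w w · 1{∂n₂=A₂}1{∂n₄=B₂} w w · 𝟙[…]` (un-normalised `P^{A₁,A₂,B₁,B₂}`-probability).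
[cite: AizenmanDuminilCopinAnnals2021, arXiv:1912.07973 Appendix A.1, Cor. A.2 (the measures P^{0x,0z,∅,∅}, P^{0x,0z,0y,0t})] -/
def fourAvoidMass (K : G.edgeFinset → ℝ) (A₁ B₁ A₂ B₂ : Finset V) (u : V) (T : Finset V) : ℝ≥0∞ :=
  ∑' pq : (Current G × Current G) × (Current G × Current G),
    epairWeight K A₁ B₁ pq.1 * epairWeight K A₂ B₂ pq.2 * fourAvoidInd u T pq

/-- Fubini, first pair inside: `M = ∑_q W₂(q) ∑_p W₁(p) 𝟙[C_p(u) ∩ (C_q(u) ∩ T) = ∅]`. [folklore] -/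
theorem fourAvoidMass_eq_tsum_snd (K : G.edgeFinset → ℝ) (A₁ B₁ A₂ B₂ : Finset V) (u : V) (T : Finset V) :
    fourAvoidMass K A₁ B₁ A₂ B₂ u T = ∑' q : Current G × Current G, epairWeight K A₂ B₂ q *
      ∑' p : Current G × Current G, epairWeight K A₁ B₁ p * avoidSetInd u ((q.1 + q.2).cluster u ∩ T) p := by
  unfold fourAvoidMass
  rw [ENNReal.tsum_prod', ENNReal.tsum_comm]
  refine tsum_congr fun q => ?_
  rw [← ENNReal.tsum_mul_left]
  refine tsum_congr fun p => ?_
  rw [fourAvoidInd_eq_avoidSetInd_fst]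
  ring

/-- Fubini, second pair inside: `M = ∑_p W₁(p) ∑_q W₂(q) 𝟙[C_q(u) ∩ (C_p(u) ∩ T) = ∅]`. [folklore] -/
theorem fourAvoidMass_eq_tsum_fst (K : G.edgeFinset → ℝ) (A₁ B₁ A₂ B₂ : Finset V) (u : V) (T : Finset V) :
    fourAvoidMass K A₁ B₁ A₂ B₂ u T = ∑' p : Current G × Current G, epairWeight K A₁ B₁ p *
      ∑' q : Current G × Current G, epairWeight K A₂ B₂ q * avoidSetInd u ((p.1 + p.2).cluster u ∩ T) q := by
  unfold fourAvoidMass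
  rw [ENNReal.tsum_prod']
  refine tsum_congr fun p => ?_
  rw [← ENNReal.tsum_mul_left]
  refine tsum_congr fun q => ?_
  rw [fourAvoidInd_eq_avoidSetInd_snd]
  ring

/-- **Removing the sources of `n₃`** (first application of Lemma A.1 in the proof of Cor. A.2):
`Z[∅] · M^{A₁,ua;A₂,B₂} ≤ Z[{u,a}] · M^{A₁,∅;A₂,B₂}`. [cite: AizenmanDuminilCopinAnnals2021, arXiv:1912.07973 Appendix A.1, proof of Cor. A.2 (first step)] -/
theorem ecurrentSum_empty_mul_fourAvoidMass_le_fst (hK : ∀ e, 0 ≤ K e) (A₁ A₂ B₂ : Finset V) (u a : V)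
    (T : Finset V) :
    ecurrentSum K ∅ * fourAvoidMass K A₁ ({u} ∆ {a}) A₂ B₂ u T ≤
      ecurrentSum K ({u} ∆ {a}) * fourAvoidMass K A₁ ∅ A₂ B₂ u T := by
  rw [fourAvoidMass_eq_tsum_snd, fourAvoidMass_eq_tsum_snd, ← ENNReal.tsum_mul_left, ← ENNReal.tsum_mul_left]
  refine ENNReal.tsum_le_tsum fun q => ?_
  calc ecurrentSum K ∅ * (epairWeight K A₂ B₂ q *
        ∑' p, epairWeight K A₁ ({u} ∆ {a}) p * avoidSetInd u ((q.1 + q.2).cluster u ∩ T) p)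
      = epairWeight K A₂ B₂ q * (ecurrentSum K ∅ *
          ∑' p, epairWeight K A₁ ({u} ∆ {a}) p * avoidSetInd u ((q.1 + q.2).cluster u ∩ T) p) := by ring
    _ ≤ epairWeight K A₂ B₂ q * (ecurrentSum K ({u} ∆ {a}) *
          ∑' p, epairWeight K A₁ ∅ p * avoidSetInd u ((q.1 + q.2).cluster u ∩ T) p) :=
        mul_le_mul' le_rfl (ecurrentSum_empty_mul_tsum_avoidSet_le hK A₁ u a _)
    _ = ecurrentSum K ({u} ∆ {a}) * (epairWeight K A₂ B₂ q *
          ∑' p, epairWeight K A₁ ∅ p * avoidSetInd u ((q.1 + q.2).cluster u ∩ T) p) := by ring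

/-- **Removing the sources of `n₄`** (second application of Lemma A.1 in the proof of Cor. A.2):
`Z[∅] · M^{A₁,B₁;A₂,ub} ≤ Z[{u,b}] · M^{A₁,B₁;A₂,∅}`. [cite: AizenmanDuminilCopinAnnals2021, arXiv:1912.07973 Appendix A.1, proof of Cor. A.2 (second step)] -/
theorem ecurrentSum_empty_mul_fourAvoidMass_le_snd (hK : ∀ e, 0 ≤ K e) (A₁ B₁ A₂ : Finset V) (u b : V)
    (T : Finset V) :
    ecurrentSum K ∅ * fourAvoidMass K A₁ B₁ A₂ ({u} ∆ {b}) u T ≤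
      ecurrentSum K ({u} ∆ {b}) * fourAvoidMass K A₁ B₁ A₂ ∅ u T := by
  rw [fourAvoidMass_eq_tsum_fst, fourAvoidMass_eq_tsum_fst, ← ENNReal.tsum_mul_left, ← ENNReal.tsum_mul_left]
  refine ENNReal.tsum_le_tsum fun p => ?_
  calc ecurrentSum K ∅ * (epairWeight K A₁ B₁ p *
        ∑' q, epairWeight K A₂ ({u} ∆ {b}) q * avoidSetInd u ((p.1 + p.2).cluster u ∩ T) q)
      = epairWeight K A₁ B₁ p * (ecurrentSum K ∅ *
          ∑' q, epairWeight K A₂ ({u} ∆ {b}) q * avoidSetInd u ((p.1 + p.2).cluster u ∩ T) q) := by ring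
    _ ≤ epairWeight K A₁ B₁ p * (ecurrentSum K ({u} ∆ {b}) *
          ∑' q, epairWeight K A₂ ∅ q * avoidSetInd u ((p.1 + p.2).cluster u ∩ T) q) :=
        mul_le_mul' le_rfl (ecurrentSum_empty_mul_tsum_avoidSet_le hK A₂ u b _)
    _ = ecurrentSum K ({u} ∆ {b}) * (epairWeight K A₁ B₁ p *
          ∑' q, epairWeight K A₂ ∅ q * avoidSetInd u ((p.1 + p.2).cluster u ∩ T) q) := by ring

/-- **Aizenman–Duminil-Copin 2021, Corollary A.2, second inequality, finite volume, current-sum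
form.** For couplings `K ≥ 0` on a finite graph, a vertex `u` (printed: `0`), vertices `a, b`
(printed: `y, t`), arbitrary source sets `A₁, A₂` of the currents `n₁, n₂` (printed: `{0,x}`, `{0,z}`)
and any vertex set `T` (printed: `S`):
`M^{A₁,ua;A₂,ub}[C_{n₁+n₃}(u) ∩ C_{n₂+n₄}(u) ∩ T = ∅] · Z[∅]² ≤ Z[{u,a}] Z[{u,b}] · M^{A₁,∅;A₂,∅}[C_{n₁+n₃}(u) ∩ C_{n₂+n₄}(u) ∩ T = ∅]`,
i.e. after normalisation `P^{A₁,A₂,ua,ub}[𝒯_u ∩ T = ∅] ≤ P^{A₁,A₂,∅,∅}[𝒯_u ∩ T = ∅]`, equivalently the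
printed `P^{0x,0z,∅,∅}[C_{n₁+n₃}(0) ∩ C_{n₂+n₄}(0) ∩ S ≠ ∅] ≤ P^{0x,0z,0y,0t}[C_{n₁+n₃}(0) ∩ C_{n₂+n₄}(0) ∩ S ≠ ∅]`
("the probability of `B_S` increases when removing sources", proof of Prop. 4.3). Two successive
applications of Lemma A.1 for the cluster of a set (Remark A.5), as printed.
[cite: AizenmanDuminilCopinAnnals2021, arXiv:1912.07973 Appendix A.1, Corollary A.2 (second inequality)] -/
theorem fourAvoidMass_mul_sq_le (hK : ∀ e, 0 ≤ K e) (A₁ A₂ : Finset V) (u a b : V) (T : Finset V) :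
    fourAvoidMass K A₁ ({u} ∆ {a}) A₂ ({u} ∆ {b}) u T * ecurrentSum K ∅ ^ 2 ≤
      ecurrentSum K ({u} ∆ {a}) * ecurrentSum K ({u} ∆ {b}) * fourAvoidMass K A₁ ∅ A₂ ∅ u T := by
  have h1 := ecurrentSum_empty_mul_fourAvoidMass_le_fst hK A₁ A₂ ({u} ∆ {b}) u a T
  have h2 := ecurrentSum_empty_mul_fourAvoidMass_le_snd hK A₁ ∅ A₂ u b T
  calc fourAvoidMass K A₁ ({u} ∆ {a}) A₂ ({u} ∆ {b}) u T * ecurrentSum K ∅ ^ 2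
      = ecurrentSum K ∅ * (ecurrentSum K ∅ * fourAvoidMass K A₁ ({u} ∆ {a}) A₂ ({u} ∆ {b}) u T) := by ring
    _ ≤ ecurrentSum K ∅ * (ecurrentSum K ({u} ∆ {a}) * fourAvoidMass K A₁ ∅ A₂ ({u} ∆ {b}) u T) :=
        mul_le_mul' le_rfl h1
    _ = ecurrentSum K ({u} ∆ {a}) * (ecurrentSum K ∅ * fourAvoidMass K A₁ ∅ A₂ ({u} ∆ {b}) u T) := by ring
    _ ≤ ecurrentSum K ({u} ∆ {a}) * (ecurrentSum K ({u} ∆ {b}) * fourAvoidMass K A₁ ∅ A₂ ∅ u T) :=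
        mul_le_mul' le_rfl h2
    _ = ecurrentSum K ({u} ∆ {a}) * ecurrentSum K ({u} ∆ {b}) * fourAvoidMass K A₁ ∅ A₂ ∅ u T := by ring

/-- **Corollary A.2, second inequality, with the removable sources on the first currents of the two
pairs** — the source layout `P^{uy,ux} ⊗ P^{ut,uz}` of the rerouted four currents in the tree's
`Current.clusteringMass` (`ClusteringToTreeBound.lean`): for arbitrary `B₁, B₂`,
`M^{ua,B₁;ub,B₂}[𝒯_u ∩ T = ∅] · Z[∅]² ≤ Z[{u,a}] Z[{u,b}] · M^{∅,B₁;∅,B₂}[𝒯_u ∩ T = ∅]`.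
[cite: AizenmanDuminilCopinAnnals2021, arXiv:1912.07973 Appendix A.1, Corollary A.2 (second inequality)] -/
theorem fourAvoidMass_mul_sq_le_left (hK : ∀ e, 0 ≤ K e) (B₁ B₂ : Finset V) (u a b : V) (T : Finset V) :
    fourAvoidMass K ({u} ∆ {a}) B₁ ({u} ∆ {b}) B₂ u T * ecurrentSum K ∅ ^ 2 ≤
      ecurrentSum K ({u} ∆ {a}) * ecurrentSum K ({u} ∆ {b}) * fourAvoidMass K ∅ B₁ ∅ B₂ u T := by
  -- exchange the two currents inside each pair: `M^{A₁,B₁;A₂,B₂} = M^{B₁,A₁;B₂,A₂}`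
  have hswap : ∀ A₁ B₁ A₂ B₂ : Finset V,
      fourAvoidMass K A₁ B₁ A₂ B₂ u T = fourAvoidMass K B₁ A₁ B₂ A₂ u T := by
    intro A₁ B₁ A₂ B₂
    unfold fourAvoidMass
    rw [← ((Equiv.prodComm (Current G) (Current G)).prodCongr
      (Equiv.prodComm (Current G) (Current G))).tsum_eq]
    refine tsum_congr fun pq => ?_
    unfold fourAvoidInd
    simp only [Equiv.prodCongr_apply, Equiv.prodComm_apply, Prod.map_fst, Prod.map_snd, Prod.fst_swap,
      Prod.snd_swap, epairWeight_swap, add_comm pq.1.2 pq.1.1, add_comm pq.2.2 pq.2.1]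
  rw [hswap, hswap ∅ B₁ ∅ B₂]
  exact fourAvoidMass_mul_sq_le hK B₁ B₂ u a b T

end Current

end Literature.Probability.LatticeModels
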